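import Summits.RiemannHypothesis.RiemannHypothesis.Theorems.IntegerScrewCensusDualDigits

/-!
# Route `IntegerScrew` — kernel checker for the census DUAL certificates (9): the term estimates, instantiated

The three one-term model estimates of `IntegerScrewCensusDualTaylor(B)` specialised to the checker's constants
(`B = 2^104`, `K₁ = 2^E D!`, `K0 = 2^{104+E} D!`, `δ = 31U`, `Δ' = Wmax/2^46`, `c ≤ c₁ ≤ D/2`, `ρ = 2c₁^{D−1}/(D−1)!`):
for an amplitude `A`, a frequency numerator `φ` with true frequency `ν` (`|2φ/2^52 − 2ν| ≤ Wmax/2^46`) and a phasor estimate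
`ζ̂ ≈ 2^104 e^{i t₀ ν}`, the real parts of `A·ζ̂·S_φ(σ)`, `A·ζ̂·S¹_φ(σ)`, `A·ζ̂·S²_φ(σ)` are within `|A|·(unit error)` of
`K0·A·cos((t₀+2σ)ν)`, `K0·A·(−2ν sin((t₀+2σ)ν))`, `K0·A·(−4ν² cos((t₀+2σ)ν))`; the phasor estimates of pair and node terms
from the node-value errors; and the one-sided cubic Taylor step of `A cos((c+4s)ν)` in `s`.
RH-free; nothing here bears on the truth of RH.
-/

set_option linter.dupNamespace false
set_option autoImplicit false

namespace Summit.RiemannHypothesis.RiemannHypothesis.Theorems.IntegerScrew.Manifest.Fast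

open Finset Complex

/-! ### Phasor algebra -/

/-- `e^{ia} e^{ib} = e^{i(a+b)}`. -/
theorem expI_mul (a b : ℝ) : exp (I * (a : ℂ)) * exp (I * (b : ℂ)) = exp (I * ((a + b : ℝ) : ℂ)) := by
  rw [← Complex.exp_add]; push_cast; ring_nf

/-- `Re e^{ix} = cos x`. -/
theorem expI_re (x : ℝ) : (exp (I * (x : ℂ))).re = Real.cos x := by
  rw [mul_comm]; exact Complex.exp_ofReal_mul_I_re x

/-- `Im e^{ix} = sin x`. -/
theorem expI_im (x : ℝ) : (exp (I * (x : ℂ))).im = Real.sin x := by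
  rw [mul_comm]; exact Complex.exp_ofReal_mul_I_im x

/-- `conj e^{ix} = e^{−ix}`. -/
theorem conj_expI (x : ℝ) : (starRingEnd ℂ) (exp (I * (x : ℂ))) = exp (I * ((-x : ℝ) : ℂ)) := by
  rw [← Complex.exp_conj, map_mul, Complex.conj_I, Complex.conj_ofReal]; push_cast; ring_nf

/-- `Re(e^{ia} e^{ib}) = cos(a+b)`. -/
theorem re_rot0 (a b : ℝ) : (exp (I * (a : ℂ)) * exp (I * (b : ℂ))).re = Real.cos (a + b) := by
  rw [expI_mul, expI_re]

/-- `Re(e^{ia} (iw) e^{ib}) = −w sin(a+b)`. -/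
theorem re_rot1 (a b w : ℝ) : (exp (I * (a : ℂ)) * (I * (w : ℂ)) * exp (I * (b : ℂ))).re = -w * Real.sin (a + b) := by
  rw [show exp (I * (a : ℂ)) * (I * (w : ℂ)) * exp (I * (b : ℂ)) = (I * w) * (exp (I * (a : ℂ)) * exp (I * (b : ℂ))) by ring,
    expI_mul, Complex.mul_re, expI_re, expI_im]
  simp

/-- `Re(e^{ia} (iw)² e^{ib}) = −w² cos(a+b)`. -/
theorem re_rot2 (a b w : ℝ) :
    (exp (I * (a : ℂ)) * (I * (w : ℂ)) ^ 2 * exp (I * (b : ℂ))).re = -w ^ 2 * Real.cos (a + b) := by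
  rw [show exp (I * (a : ℂ)) * (I * (w : ℂ)) ^ 2 * exp (I * (b : ℂ)) = (((-w ^ 2 : ℝ) : ℂ)) * (exp (I * (a : ℂ)) * exp (I * (b : ℂ))) by
    push_cast; rw [mul_pow, Complex.I_sq]; ring, expI_mul, Complex.re_ofReal_mul, expI_re]

/-- `Re((A : ℤ)·z) = A·Re z`. -/
theorem re_intCast_mul (A : ℤ) (z : ℂ) : (((A : ℤ) : ℂ) * z).re = (A : ℝ) * z.re := by
  rw [show ((A : ℤ) : ℂ) = ((A : ℝ) : ℂ) by norm_cast, Complex.re_ofReal_mul]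

/-! ### Phasor estimates of the terms -/

/-- **Pair phasor**: `‖ẑ_a ẑ_b^* − 2^104 e_a e_b^*‖ ≤ 2^104·31U` and `‖ẑ_a ẑ_b^*‖ ≤ 2^105` (`225U ≤ 1`). -/
theorem pair_phasor {za zb ea eb : ℂ} {U : ℝ} (hU0 : 0 ≤ U) (hU : 225 * U ≤ 1) (hea : ‖ea‖ = 1) (heb : ‖eb‖ = 1)
    (ha : ‖za - 2 ^ 52 * ea‖ ≤ 2 ^ 52 * (15 * U)) (hb : ‖zb - 2 ^ 52 * eb‖ ≤ 2 ^ 52 * (15 * U)) :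
    ‖za * (starRingEnd ℂ) zb - (2 ^ 104 : ℂ) * (ea * (starRingEnd ℂ) eb)‖ ≤ 2 ^ 104 * (31 * U) ∧
      ‖za * (starRingEnd ℂ) zb‖ ≤ 2 ^ 105 := by
  have hza : ‖za‖ ≤ 2 ^ 52 * (1 + 15 * U) := by
    have h1 := norm_add_le (za - 2 ^ 52 * ea) (2 ^ 52 * ea)
    rw [sub_add_cancel, norm_mul, hea, mul_one] at h1
    have : ‖(2 ^ 52 : ℂ)‖ = 2 ^ 52 := by simp
    rw [this] at h1; linarith
  have hzb : ‖(starRingEnd ℂ) zb‖ ≤ 2 ^ 52 * (1 + 15 * U) := by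
    rw [Complex.norm_conj]
    have h1 := norm_add_le (zb - 2 ^ 52 * eb) (2 ^ 52 * eb)
    rw [sub_add_cancel, norm_mul, heb, mul_one] at h1
    have : ‖(2 ^ 52 : ℂ)‖ = 2 ^ 52 := by simp
    rw [this] at h1; linarith
  have hcb : ‖(starRingEnd ℂ) zb - 2 ^ 52 * (starRingEnd ℂ) eb‖ ≤ 2 ^ 52 * (15 * U) := by
    rw [show (starRingEnd ℂ) zb - 2 ^ 52 * (starRingEnd ℂ) eb = (starRingEnd ℂ) (zb - 2 ^ 52 * eb) by
      rw [map_sub, map_mul, map_pow, map_ofNat], Complex.norm_conj]; exact hb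
  have hceb : ‖(starRingEnd ℂ) eb‖ = 1 := by rw [Complex.norm_conj, heb]
  constructor
  · rw [show za * (starRingEnd ℂ) zb - (2 ^ 104 : ℂ) * (ea * (starRingEnd ℂ) eb) =
        za * ((starRingEnd ℂ) zb - 2 ^ 52 * (starRingEnd ℂ) eb) + 2 ^ 52 * ((za - 2 ^ 52 * ea) * (starRingEnd ℂ) eb) by ring]
    refine (norm_add_le _ _).trans ?_
    rw [norm_mul, norm_mul, norm_mul, hceb, mul_one]
    have : ‖(2 ^ 52 : ℂ)‖ = 2 ^ 52 := by simp
    rw [this]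
    have h15 : 15 * U * (15 * U) ≤ U := by nlinarith
    nlinarith [mul_le_mul hza hcb (norm_nonneg _) (by positivity), norm_nonneg za]
  · rw [norm_mul]
    have h15 : 15 * U ≤ 1 / 15 := by linarith
    calc ‖za‖ * ‖(starRingEnd ℂ) zb‖ ≤ (2 ^ 52 * (1 + 15 * U)) * (2 ^ 52 * (1 + 15 * U)) :=
          mul_le_mul hza hzb (norm_nonneg _) (by positivity)
      _ ≤ 2 ^ 105 := by nlinarith

/-- **Node phasor**: `‖2^52 ẑ_a − 2^104 e_a‖ ≤ 2^104·31U` and `‖2^52 ẑ_a‖ ≤ 2^105` (`225U ≤ 1`). -/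
theorem node_phasor {za ea : ℂ} {U : ℝ} (hU0 : 0 ≤ U) (hU : 225 * U ≤ 1) (hea : ‖ea‖ = 1)
    (ha : ‖za - 2 ^ 52 * ea‖ ≤ 2 ^ 52 * (15 * U)) :
    ‖((SCL : ℕ) : ℂ) * za - (2 ^ 104 : ℂ) * ea‖ ≤ 2 ^ 104 * (31 * U) ∧ ‖((SCL : ℕ) : ℂ) * za‖ ≤ 2 ^ 105 := by
  have hS : ((SCL : ℕ) : ℂ) = 2 ^ 52 := by norm_num [SCL]
  rw [hS]
  have h2 : ‖(2 ^ 52 : ℂ)‖ = 2 ^ 52 := by simp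
  constructor
  · rw [show (2 ^ 52 : ℂ) * za - 2 ^ 104 * ea = 2 ^ 52 * (za - 2 ^ 52 * ea) by ring, norm_mul, h2]
    nlinarith
  · have h1 := norm_add_le (za - 2 ^ 52 * ea) (2 ^ 52 * ea)
    rw [sub_add_cancel, norm_mul, hea, mul_one, h2] at h1
    rw [norm_mul, h2]
    nlinarith

/-! ### The remainder ratio `ρ` -/

/-- `c^{m+1}/(m+1)! ≤ c^m/m!` for `0 ≤ c ≤ m+1`. -/
theorem pow_div_fact_step {c : ℝ} {m : ℕ} (hc0 : 0 ≤ c) (hc : c ≤ (m : ℝ) + 1) :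
    c ^ (m + 1) / (m + 1).factorial ≤ c ^ m / m.factorial := by
  rw [Nat.factorial_succ, pow_succ]
  push_cast
  rw [div_le_div_iff₀ (by positivity) (by positivity)]
  have h0 : (0 : ℝ) ≤ c ^ m * (m.factorial : ℝ) := by positivity
  nlinarith

/-- **The three remainder ratios are below `ρ = 2c₁^{D−1}/(D−1)!`** (`0 ≤ c ≤ c₁ ≤ D/2`, `D = D'+1`). -/
theorem rho_le {c c1 : ℝ} {D' : ℕ} (hc0 : 0 ≤ c) (hc : c ≤ c1) (hc1 : c1 ≤ ((D' : ℝ) + 1) / 2) :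
    2 * c ^ D' / (D').factorial ≤ 2 * c1 ^ D' / (D').factorial ∧
      2 * c ^ (D' + 1) / (D' + 1).factorial ≤ 2 * c1 ^ D' / (D').factorial ∧
        2 * c ^ (D' + 2) / (D' + 2).factorial ≤ 2 * c1 ^ D' / (D').factorial := by
  have h0 : 2 * c ^ D' / (D').factorial ≤ 2 * c1 ^ D' / (D').factorial := by
    rw [mul_div_assoc, mul_div_assoc]
    exact mul_le_mul_of_nonneg_left (div_le_div_of_nonneg_right (pow_le_pow_left₀ hc0 hc _) (by positivity)) (by norm_num)
  have h1 : c ^ (D' + 1) / (D' + 1).factorial ≤ c ^ D' / (D').factorial := pow_div_fact_step hc0 (by linarith)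
  have h2 : c ^ (D' + 2) / (D' + 2).factorial ≤ c ^ (D' + 1) / (D' + 1).factorial :=
    pow_div_fact_step (m := D' + 1) hc0 (by push_cast; linarith)
  refine ⟨h0, ?_, ?_⟩
  · calc 2 * c ^ (D' + 1) / (D' + 1).factorial = 2 * (c ^ (D' + 1) / (D' + 1).factorial) := by ring
      _ ≤ 2 * (c ^ D' / (D').factorial) := by linarith
      _ = 2 * c ^ D' / (D').factorial := by ring
      _ ≤ _ := h0
  · calc 2 * c ^ (D' + 2) / (D' + 2).factorial = 2 * (c ^ (D' + 2) / (D' + 2).factorial) := by ring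
      _ ≤ 2 * (c ^ D' / (D').factorial) := by linarith
      _ = 2 * c ^ D' / (D').factorial := by ring
      _ ≤ _ := h0

/-- `K0 = 2^104 · K₁`. -/
theorem K0N_eq (D E : ℕ) : (K0N D E : ℝ) = 2 ^ 104 * ((2 ^ E * Nat.factorial D : ℕ) : ℝ) := by
  unfold K0N; push_cast; rw [pow_add]; ring

/-! ### The three term estimates -/

/-- **Value of one term**: `|Re(A ζ̂ S_φ(σ)) − K0 A cos((t₀+2σ)ν)| ≤ |A|·(K0(31U(1+ρ) + ρ + Wmax/2^46) + (D+1)2^105)`. -/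
theorem term_value {D' E : ℕ} {A : ℤ} {φ : ℕ} {ν t0 σ U c1 : ℝ} {Wm : ℕ} {ζh : ℂ} (hU0 : 0 ≤ U)
    (hζh : ‖ζh - (2 ^ 104 : ℂ) * exp (I * ((t0 * ν : ℝ) : ℂ))‖ ≤ 2 ^ 104 * (31 * U)) (hζn : ‖ζh‖ ≤ 2 ^ 105)
    (hν : |2 * (φ : ℝ) / 2 ^ 52 - 2 * ν| ≤ (Wm : ℝ) / 2 ^ 46) (hc : 2 * (φ : ℝ) / 2 ^ 52 ≤ c1)
    (hc1 : c1 ≤ ((D' : ℝ) + 1) / 2) (hσ : |σ| ≤ 1) :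
    |(((A : ℤ) : ℂ) * (ζh * wSer (kConsts (D' + 1) E) φ σ)).re - (K0N (D' + 1) E : ℝ) * A * Real.cos ((t0 + 2 * σ) * ν)| ≤
      |(A : ℝ)| * ((K0N (D' + 1) E : ℝ) * (31 * U * (1 + 2 * c1 ^ D' / (D').factorial) + 2 * c1 ^ D' / (D').factorial +
        (Wm : ℝ) / 2 ^ 46) + ((D' : ℝ) + 2) * 2 ^ 105) := by
  have hc0 : 0 ≤ 2 * (φ : ℝ) / 2 ^ 52 := by positivity
  have h := term_value_err (n := D' + 2) (K1 := 2 ^ E * Nat.factorial (D' + 1)) (B := 2 ^ 104) (c := 2 * (φ : ℝ) / 2 ^ 52)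
    (ν' := 2 * ν) (δ := 31 * U) (Δ' := (Wm : ℝ) / 2 ^ 46) (σ := σ) (W := wAt (kConsts (D' + 1) E) φ)
    (ζ := exp (I * ((t0 * ν : ℝ) : ℂ))) (ζh := ζh) (by norm_num) (fun k hk => wAt_abs (by omega) φ) hc0
    (by push_cast; linarith) (Complex.norm_exp_I_mul_ofReal _) (by push_cast; simpa using hζh) hν hσ
  obtain ⟨-, -, hρ⟩ := rho_le hc0 hc hc1
  rw [re_rot0, show t0 * ν + σ * (2 * ν) = (t0 + 2 * σ) * ν by ring, ← K0N_eq] at h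
  have hser : wSer (kConsts (D' + 1) E) φ σ = ∑ k ∈ range (D' + 2), (wAt (kConsts (D' + 1) E) φ k : ℂ) * (I * σ) ^ k := by
    unfold wSer; rw [length_kConsts]
  rw [re_intCast_mul, hser, show (K0N (D' + 1) E : ℝ) * A * Real.cos ((t0 + 2 * σ) * ν) =
    (A : ℝ) * ((K0N (D' + 1) E : ℝ) * Real.cos ((t0 + 2 * σ) * ν)) by ring, ← mul_sub, abs_mul]
  refine mul_le_mul_of_nonneg_left (h.trans ?_) (abs_nonneg _)
  have hK : (0 : ℝ) ≤ (K0N (D' + 1) E : ℝ) := by positivity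
  have hρ0 : 0 ≤ 2 * (2 * (φ : ℝ) / 2 ^ 52) ^ (D' + 2) / (D' + 2).factorial := by positivity
  push_cast
  have e1 : ((D' : ℝ) + 2) * ‖ζh‖ ≤ ((D' : ℝ) + 2) * 2 ^ 105 := mul_le_mul_of_nonneg_left hζn (by positivity)
  nlinarith [mul_le_mul_of_nonneg_left hρ hK, mul_le_mul_of_nonneg_left (mul_le_mul_of_nonneg_left hρ (by positivity : (0:ℝ) ≤ 31 * U)) hK]

/-- **First derivative of one term**:
`|Re(A ζ̂ S¹_φ(σ)) − K0 A (−2ν sin((t₀+2σ)ν))| ≤ |A|·(K0(c₁(31U(1+ρ)+ρ) + Wmax/2^46 (1+c₁)) + (D+1)²2^105)`. -/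
theorem term_deriv {D' E : ℕ} {A : ℤ} {φ : ℕ} {ν t0 σ U c1 : ℝ} {Wm : ℕ} {ζh : ℂ} (hU0 : 0 ≤ U)
    (hζh : ‖ζh - (2 ^ 104 : ℂ) * exp (I * ((t0 * ν : ℝ) : ℂ))‖ ≤ 2 ^ 104 * (31 * U)) (hζn : ‖ζh‖ ≤ 2 ^ 105)
    (hν : |2 * (φ : ℝ) / 2 ^ 52 - 2 * ν| ≤ (Wm : ℝ) / 2 ^ 46) (hc : 2 * (φ : ℝ) / 2 ^ 52 ≤ c1)
    (hνc : 2 * |ν| ≤ c1) (hc1 : c1 ≤ ((D' : ℝ) + 1) / 2) (hσ : |σ| ≤ 1) :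
    |(((A : ℤ) : ℂ) * (ζh * wSer1 (kConsts (D' + 1) E) φ σ)).re -
        (K0N (D' + 1) E : ℝ) * A * (-(2 * ν) * Real.sin ((t0 + 2 * σ) * ν))| ≤
      |(A : ℝ)| * ((K0N (D' + 1) E : ℝ) * (c1 * (31 * U * (1 + 2 * c1 ^ D' / (D').factorial) + 2 * c1 ^ D' / (D').factorial) +
        (Wm : ℝ) / 2 ^ 46 * (1 + c1)) + ((D' : ℝ) + 2) ^ 2 * 2 ^ 105) := by
  have hc0 : 0 ≤ 2 * (φ : ℝ) / 2 ^ 52 := by positivity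
  have h := term_deriv_err (n := D' + 1) (K1 := 2 ^ E * Nat.factorial (D' + 1)) (B := 2 ^ 104) (c := 2 * (φ : ℝ) / 2 ^ 52)
    (ν' := 2 * ν) (δ := 31 * U) (Δ' := (Wm : ℝ) / 2 ^ 46) (σ := σ) (W := wAt (kConsts (D' + 1) E) φ)
    (ζ := exp (I * ((t0 * ν : ℝ) : ℂ))) (ζh := ζh) (by norm_num) (fun k hk => wAt_abs (by omega) φ) hc0
    (by push_cast; linarith) (Complex.norm_exp_I_mul_ofReal _) (by push_cast; simpa using hζh) hν hσ
  obtain ⟨-, hρ, -⟩ := rho_le hc0 hc hc1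
  rw [show (((2 : ℝ) * ν : ℝ) : ℂ) = ((2 * ν : ℝ) : ℂ) from rfl, re_rot1, show t0 * ν + σ * (2 * ν) = (t0 + 2 * σ) * ν by ring,
    ← K0N_eq] at h
  have hser : wSer1 (kConsts (D' + 1) E) φ σ =
      ∑ k ∈ range (D' + 1), ((k + 1 : ℕ) : ℂ) * (wAt (kConsts (D' + 1) E) φ (k + 1) : ℂ) * I ^ (k + 1) * (σ : ℂ) ^ k := by
    unfold wSer1; rw [length_kConsts, show D' + 1 + 1 - 1 = D' + 1 by omega]
  rw [re_intCast_mul, hser, show (K0N (D' + 1) E : ℝ) * A * (-(2 * ν) * Real.sin ((t0 + 2 * σ) * ν)) =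
    (A : ℝ) * ((K0N (D' + 1) E : ℝ) * (-(2 * ν) * Real.sin ((t0 + 2 * σ) * ν))) by ring, ← mul_sub, abs_mul]
  refine mul_le_mul_of_nonneg_left (h.trans ?_) (abs_nonneg _)
  have hK : (0 : ℝ) ≤ (K0N (D' + 1) E : ℝ) := by positivity
  have hρ0 : 0 ≤ 2 * (2 * (φ : ℝ) / 2 ^ 52) ^ (D' + 1) / (D' + 1).factorial := by positivity
  have hν2 : |2 * ν| ≤ c1 := by rw [abs_mul, abs_two]; exact hνc
  push_cast
  have e1 : ((D' : ℝ) + 1 + 1) ^ 2 * ‖ζh‖ ≤ ((D' : ℝ) + 2) ^ 2 * 2 ^ 105 := by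
    rw [show (D' : ℝ) + 1 + 1 = D' + 2 by ring]; exact mul_le_mul_of_nonneg_left hζn (by positivity)
  -- X := δ(1+ρ₁)+ρ₁ ≤ Y := δ(1+ρ)+ρ, and c ≤ c1
  set c := 2 * (φ : ℝ) / 2 ^ 52 with hcdef
  set ρ1 := 2 * c ^ (D' + 1) / (D' + 1).factorial
  set ρ := 2 * c1 ^ D' / (D').factorial
  have hXY : c * (31 * U) * (1 + ρ1) + c * ρ1 ≤ c1 * (31 * U * (1 + ρ) + ρ) := by
    have : (31 * U) * (1 + ρ1) + ρ1 ≤ 31 * U * (1 + ρ) + ρ := by nlinarith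
    calc c * (31 * U) * (1 + ρ1) + c * ρ1 = c * ((31 * U) * (1 + ρ1) + ρ1) := by ring
      _ ≤ c1 * (31 * U * (1 + ρ) + ρ) := mul_le_mul hc this (by positivity) (by linarith)
  have hW : (Wm : ℝ) / 2 ^ 46 * (1 + |2 * ν|) ≤ (Wm : ℝ) / 2 ^ 46 * (1 + c1) :=
    mul_le_mul_of_nonneg_left (by linarith) (by positivity)
  nlinarith [mul_le_mul_of_nonneg_left (add_le_add hXY hW) hK]

/-- **Second derivative of one term**:
`|Re(A ζ̂ S²_φ(σ)) − K0 A (−4ν² cos((t₀+2σ)ν))| ≤ |A|·(K0(c₁²(31U(1+ρ)+ρ) + Wmax/2^46 (2c₁+c₁²)) + (D+2)³2^105)`. -/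
theorem term_deriv2 {D' E : ℕ} {A : ℤ} {φ : ℕ} {ν t0 σ U c1 : ℝ} {Wm : ℕ} {ζh : ℂ} (hU0 : 0 ≤ U)
    (hζh : ‖ζh - (2 ^ 104 : ℂ) * exp (I * ((t0 * ν : ℝ) : ℂ))‖ ≤ 2 ^ 104 * (31 * U)) (hζn : ‖ζh‖ ≤ 2 ^ 105)
    (hν : |2 * (φ : ℝ) / 2 ^ 52 - 2 * ν| ≤ (Wm : ℝ) / 2 ^ 46) (hc : 2 * (φ : ℝ) / 2 ^ 52 ≤ c1)
    (hνc : 2 * |ν| ≤ c1) (hc1 : c1 ≤ ((D' : ℝ) + 1) / 2) (hσ : |σ| ≤ 1) :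
    |(((A : ℤ) : ℂ) * (ζh * wSer2 (kConsts (D' + 1) E) φ σ)).re -
        (K0N (D' + 1) E : ℝ) * A * (-(2 * ν) ^ 2 * Real.cos ((t0 + 2 * σ) * ν))| ≤
      |(A : ℝ)| * ((K0N (D' + 1) E : ℝ) * (c1 ^ 2 * (31 * U * (1 + 2 * c1 ^ D' / (D').factorial) + 2 * c1 ^ D' / (D').factorial) +
        (Wm : ℝ) / 2 ^ 46 * (2 * c1 + c1 ^ 2)) + ((D' : ℝ) + 3) ^ 3 * 2 ^ 105) := by
  have hc0 : 0 ≤ 2 * (φ : ℝ) / 2 ^ 52 := by positivity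
  have h := term_deriv2_err (n := D') (K1 := 2 ^ E * Nat.factorial (D' + 1)) (B := 2 ^ 104) (c := 2 * (φ : ℝ) / 2 ^ 52)
    (ν' := 2 * ν) (δ := 31 * U) (Δ' := (Wm : ℝ) / 2 ^ 46) (σ := σ) (W := wAt (kConsts (D' + 1) E) φ)
    (ζ := exp (I * ((t0 * ν : ℝ) : ℂ))) (ζh := ζh) (by norm_num) (fun k hk => wAt_abs (by omega) φ) hc0
    (by linarith) (Complex.norm_exp_I_mul_ofReal _) (by push_cast; simpa using hζh) hν hσ
  obtain ⟨hρ, -, -⟩ := rho_le hc0 hc hc1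
  rw [show (((2 : ℝ) * ν : ℝ) : ℂ) = ((2 * ν : ℝ) : ℂ) from rfl, re_rot2, show t0 * ν + σ * (2 * ν) = (t0 + 2 * σ) * ν by ring,
    ← K0N_eq] at h
  have hser : wSer2 (kConsts (D' + 1) E) φ σ = ∑ k ∈ range D', ((k + 1 : ℕ) : ℂ) * ((k + 2 : ℕ) : ℂ) *
      (wAt (kConsts (D' + 1) E) φ (k + 2) : ℂ) * I ^ (k + 2) * (σ : ℂ) ^ k := by
    unfold wSer2; rw [length_kConsts, show D' + 1 + 1 - 2 = D' by omega]
  rw [re_intCast_mul, hser, show (K0N (D' + 1) E : ℝ) * A * (-(2 * ν) ^ 2 * Real.cos ((t0 + 2 * σ) * ν)) =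
    (A : ℝ) * ((K0N (D' + 1) E : ℝ) * (-(2 * ν) ^ 2 * Real.cos ((t0 + 2 * σ) * ν))) by ring, ← mul_sub, abs_mul]
  refine mul_le_mul_of_nonneg_left (h.trans ?_) (abs_nonneg _)
  have hK : (0 : ℝ) ≤ (K0N (D' + 1) E : ℝ) := by positivity
  have hρ0 : 0 ≤ 2 * (2 * (φ : ℝ) / 2 ^ 52) ^ D' / (D').factorial := by positivity
  have hν2 : |2 * ν| ≤ c1 := by rw [abs_mul, abs_two]; exact hνc
  have hν0 : 0 ≤ |2 * ν| := abs_nonneg _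
  have e1 : ((D' : ℝ) + 2) ^ 3 * ‖ζh‖ ≤ ((D' : ℝ) + 3) ^ 3 * 2 ^ 105 :=
    mul_le_mul (pow_le_pow_left₀ (by positivity) (by linarith) 3) hζn (norm_nonneg _) (by positivity)
  set c := 2 * (φ : ℝ) / 2 ^ 52 with hcdef
  set ρ2 := 2 * c ^ D' / (D').factorial
  set ρ := 2 * c1 ^ D' / (D').factorial
  have hcc : c ^ 2 ≤ c1 ^ 2 := pow_le_pow_left₀ hc0 hc 2
  have hXY : c ^ 2 * (31 * U) * (1 + ρ2) + c ^ 2 * ρ2 ≤ c1 ^ 2 * (31 * U * (1 + ρ) + ρ) := by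
    have : (31 * U) * (1 + ρ2) + ρ2 ≤ 31 * U * (1 + ρ) + ρ := by nlinarith
    calc c ^ 2 * (31 * U) * (1 + ρ2) + c ^ 2 * ρ2 = c ^ 2 * ((31 * U) * (1 + ρ2) + ρ2) := by ring
      _ ≤ c1 ^ 2 * (31 * U * (1 + ρ) + ρ) := mul_le_mul hcc this (by positivity) (by positivity)
  have hW : (Wm : ℝ) / 2 ^ 46 * (c + |2 * ν| + |2 * ν| ^ 2) ≤ (Wm : ℝ) / 2 ^ 46 * (2 * c1 + c1 ^ 2) :=
    mul_le_mul_of_nonneg_left (by nlinarith [pow_le_pow_left₀ hν0 hν2 2]) (by positivity)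
  nlinarith [mul_le_mul_of_nonneg_left (add_le_add hXY hW) hK]

/-! ### The cubic Taylor step of one true term -/

/-- **One-sided cubic step of `A cos((c+4s)ν)` in `s`**: for `|ν| ≤ 8`, `0 ≤ u ≤ 1/16` and any real amplitude `A`,
`A cos((c+4(s+u))ν) ≥ A cos((c+4s)ν) + A(−4ν sin((c+4s)ν))u + A(−16ν² cos((c+4s)ν))/2·u² − |A|(64/3)|ν|³u³`. -/
theorem term_step {A ν cc s u : ℝ} (hν : |ν| ≤ 8) (hu0 : 0 ≤ u) (hu : u ≤ 1 / 16) :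
    A * Real.cos ((cc + 4 * s) * ν) + A * (-(4 * ν) * Real.sin ((cc + 4 * s) * ν)) * u +
        A * (-(4 * ν) ^ 2 * Real.cos ((cc + 4 * s) * ν)) / 2 * u ^ 2 - |A| * (64 / 3) * |ν| ^ 3 * u ^ 3 ≤
      A * Real.cos ((cc + 4 * (s + u)) * ν) := by
  have hωu : |4 * ν * u| ≤ 2 := by
    rw [abs_mul, abs_mul, abs_of_nonneg hu0, show |(4 : ℝ)| = 4 by norm_num]
    nlinarith [abs_nonneg ν]
  have hcube : |4 * ν * u| ^ 3 / 3 = (64 / 3) * |ν| ^ 3 * u ^ 3 := by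
    rw [abs_mul, abs_mul, abs_of_nonneg hu0, show |(4 : ℝ)| = 4 by norm_num]; ring
  have key : ∀ (ζ : ℂ), ‖ζ‖ = 1 →
      (ζ * exp (I * (((4 * ν) * s : ℝ) : ℂ))).re + (ζ * (I * (((4 * ν : ℝ)) : ℂ)) * exp (I * (((4 * ν) * s : ℝ) : ℂ))).re * u +
        (ζ * (I * (((4 * ν : ℝ)) : ℂ)) ^ 2 * exp (I * (((4 * ν) * s : ℝ) : ℂ))).re / 2 * u ^ 2 - (64 / 3) * |ν| ^ 3 * u ^ 3 ≤
      (ζ * exp (I * (((4 * ν) * (s + u) : ℝ) : ℂ))).re := by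
    intro ζ hζ
    have := term_step3 hζ (4 * ν) s u hωu
    rw [hcube] at this
    push_cast at this ⊢
    exact this
  have e0 : ∀ x : ℝ, (exp (I * ((cc * ν : ℝ) : ℂ)) * exp (I * (((4 * ν) * x : ℝ) : ℂ))).re = Real.cos ((cc + 4 * x) * ν) := by
    intro x; rw [re_rot0]; ring_nf
  have e1 : (exp (I * ((cc * ν : ℝ) : ℂ)) * (I * ((4 * ν : ℝ) : ℂ)) * exp (I * (((4 * ν) * s : ℝ) : ℂ))).re =
      -(4 * ν) * Real.sin ((cc + 4 * s) * ν) := by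
    rw [re_rot1]; ring_nf
  have e2 : (exp (I * ((cc * ν : ℝ) : ℂ)) * (I * ((4 * ν : ℝ) : ℂ)) ^ 2 * exp (I * (((4 * ν) * s : ℝ) : ℂ))).re =
      -(4 * ν) ^ 2 * Real.cos ((cc + 4 * s) * ν) := by
    rw [re_rot2]; ring_nf
  rcases le_or_gt 0 A with hA | hA
  · have h := key (exp (I * ((cc * ν : ℝ) : ℂ))) (Complex.norm_exp_I_mul_ofReal _)
    rw [e0, e0, e1, e2] at h
    rw [abs_of_nonneg hA]
    nlinarith [mul_le_mul_of_nonneg_left h hA]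
  · have h := key (-exp (I * ((cc * ν : ℝ) : ℂ))) (by rw [norm_neg, Complex.norm_exp_I_mul_ofReal])
    simp only [neg_mul, Complex.neg_re] at h
    rw [e0, e0, e1, e2] at h
    rw [abs_of_neg hA]
    nlinarith [mul_le_mul_of_nonneg_left h (neg_nonneg.2 hA.le)]

end Summit.RiemannHypothesis.RiemannHypothesis.Theorems.IntegerScrew.Manifest.Fast
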